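import Literature.NumberTheory.Rogawski1990.ArchBouazizSpace                   -- ★ (D2) `ArchBouazizSpaceH` and its clauses (brings ★ `ArchBouazizJumpClause`: `bzTwistedDeriv`, `bzAdaptedVec`, `nrm`, `cayPt`; ★ (COORD))
import Literature.NumberTheory.Rogawski1990.ArchBouazizClassMap                -- ★ p851469 `bzClassMap`, `continuous_bzClassMap`, `bzClassMap_add_angleShift`, `bzClassMap_insert_cayPt`
import Literature.NumberTheory.Rogawski1990.ArchBouazizJumpPropagation         -- ★ `contDiff_archERho`
import Literature.NumberTheory.Rogawski1990.ArchTransfFamilyJumpJets           -- ★ (LH7-p02) letter dictionary `bzAdaptedVec_eq_hcAdaptedVec`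
import Literature.NumberTheory.Rogawski1990.ArchTransfFamilyWallGeometry       -- ★ (F0P3a-p09) `exists_basis_hcAdaptedVec` (the adapted letters form a basis)
import Literature.Analysis.Calculus.SmoothGluingAcrossHyperplaneDense          -- ★ (F0P3a-p02) `contDiffOn_extendFrom_of_tendsto_iteratedFDeriv_ray_basis_of_dense`
import Literature.Analysis.Calculus.BoundedJetsLeibnizReflection               -- ★ `bddAbove_norm_iteratedFDeriv_mul_inter_of_isCompact`
import HarnessLib

/-!
# (W1) ZERO-JUMP GLUING ACROSS SEVERAL NONCOMPACT IMAGINARY WALLS: a family with bounded jets and ZERO (I₃)-jumps at the semiregular wall points extends `C^∞`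
# across the walls, corners included (Bouaziz 1994 §3.2 (I₁)–(I₃), §4 proof of Thm 4.1.1 pp. 585–586; Shelstad 1979 §4)

Topic `NumberTheory/Rogawski1990`; namespace `Literature.NumberTheory.Rogawski1990`.  THEOREMS ONLY (no `def`, no instance, no notation, no axiom, no named fact, no `sorry`;
plumbing helpers are `private`).  Cell `pub/hodgecm-mathlib`, crux H413 (`stmt-HodgeConjecture-24833`), line LH3 (closer stub `stub_N9`, DIRECT ROAD), letter L3′, organ
O-L3′-S-WALL; W-road brick **(W1)∕(W1′)** (W-ROAD CENSUS v1 6129001bfae4ccc0 of LH3-p01 (g6), dealer LH3-plan (g4) RULING #26; author LH7-p04 (g6)); lane `--kind proof --supports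
stmt-HodgeConjecture-24833`; count-neutral.  CONSUMER: the `hW1` organ of ★ p851576 `wallGerm_classMultiple_of_parts` (`ArchBouazizWallClassMultiple`), token for token after
`(jcH S P b hPS)` — `hW1 := exists_contDiffOn_tube_eq_archERho_mul_of_eq_zero jcH S P b hPS`.

THE MATHEMATICS.  In Bouaziz's finite-filtration proof of the surjectivity of `J^st` (descending induction on the number of split places of the chart), the DIFFERENCE family
`D = Ψ − J^st(f)` of one level vanishes near the base class on every more-split chart; by (I₃) every jump of the twisted family `e^{ρ}·D` across the remaining noncompact
imaginary walls is `jcH · i^# ·` (a jet of the next chart's twisted family at the Cayley point) `= 0`, so `e^{ρ}·D` extends `C^∞` across those walls.  This file proves the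
extension statement in full generality:
* §1 sheet geometry: the pushes `c + t•v₀` (off every wall, into `RegS`) and `c + t•v₁` (along a wall of `w`, onto its semiregular part) for small `t > 0`, and the separation of
  the `2π`-sheets of a wall;
* §2 **`contDiffOn_extendFrom_inRegS_of_hasOneSidedJump_zero`** (group-free core): `F` `C^∞` on `N ∩ InRegS S` with locally bounded jets ((I₁)(I₂)) and ZERO ray jumps of all
  adapted-word jets (★ `bzAdaptedVec`) at every SEMIREGULAR point of every sheet of the walls of the places `P` meeting the open `N` ⇒ ★ `extendFrom (N ∩ InRegS S) F` is `C^∞` on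
  `N` — induction on `P`; per sheet ★ `contDiffOn_extendFrom_of_tendsto_iteratedFDeriv_ray_basis_of_dense` (F0P3a-p02) with the ★ adapted basis `exists_basis_hcAdaptedVec` (F0P3a-p09)
  read through ★ `bzAdaptedVec_eq_hcAdaptedVec` (LH7-p02); the bounds at the later walls' points and the identification of the new glue with the old one use the density of `RegS`
  from the push direction; rider `extendFrom_inRegS_eq_self`;
* §3 **`exists_contDiffOn_tube_eq_archERho_mul_of_eq_zero`** ((W1′), tube currency = `hW1`): for `D ∈ ArchBouazizSpaceH jcH` vanishing on the regular `ε`-tubes of the charts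
  `insert w S`, `w ∈ P`, the twisted family `archERho S · D S` agrees on the in-regular part of the class `ε`-tube of `S` with a function `C^∞` on the whole tube: the Cayley-side
  jet of (I₃) vanishes (`D S′ ≡ 0` on the open tube ∩ `InRegS S′` by continuity from `RegS`, `eq_zero_of_eq_zero_on_regS_tube`; ★ `bzClassMap_insert_cayPt`), the twist is undone
  (★ `archERho_ne_zero`), the other sheets follow from (P) + ★ `archERho_add_angleShift_zero` (`F(c + 2πk e_{w,0}) = (−1)^k F(c)`, ★ `iteratedFDeriv_comp_add_right`), and the (I₁)
  bounds of the product come from ★ `bddAbove_norm_iteratedFDeriv_mul_inter_of_isCompact`.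
HONEST LABEL: L3′ stays «S-road organ-complete modulo (Σ-WALL) PRINT» until (W2c), (W3-asm) and the payer are ★; HC_CM is proved only modulo the 7 printed citations
(2 remaining: hLiu418 = stmt-HodgeConjecture-24832, h413 = stmt-HodgeConjecture-24833) until rung 0 closes; this file is calculus gluing and pays nothing by itself.

## References
* [Bouaziz1994IntegralesOrbitales] A. Bouaziz, *Intégrales orbitales sur les groupes de Lie réductifs*, Ann. Sci. ÉNS (4) 27 (1994) 573–609, §3.1–3.2 (I₁)–(I₃) pp. 579–580,
  §4 proof of Thm 4.1.1 pp. 585–586 (finite filtration), §5.1 p. 588.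
* [Shelstad1979] D. Shelstad, *Characters and inner forms of a quasi-split group over ℝ*, Compositio Math. 39 (1979), §4 pp. 22–25 (semiregular points, one-sided limits).

## Mathlib ∕ tree search
`lean search 'extendFrom.*InRegS|zero.*jump.*glu|ZeroJump'`: ★ `SmoothGluingAcrossHyperplane{,Dense,Ray}` (one hyperplane; the iteration over several walls is announced there but
not carried out), ★ `ArchHCSmoothBoundedStrata` (bounds, not gluing) — the multi-wall gluing and its tube form are new.
-/

set_option autoImplicit false

noncomputable section

open Set Filter Topology Complex Function
open scoped ContDiff
open Literature.NumberTheory.Automorphic.Shelstad1979.StableOrbitalIntegrals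
open Literature.NumberTheory.Automorphic.ArchCartan
open Literature.Analysis.Calculus

namespace Literature.NumberTheory.Rogawski1990

variable {W : Type*} [Fintype W] [DecidableEq W]

/-! ## §1 Small geometry of the wall sheets: pushes off the walls, sheet separation -/

section Sheets

omit [Fintype W] [DecidableEq W] in
/-- Off a short interval: `e^{i(a+t)} ≠ e^{ib}` for all small `t > 0`. [cite: Shelstad1979, §4 p. 22] -/
private theorem eventually_nhdsGT_circleExp_add_ne (a b : ℝ) : ∀ᶠ t : ℝ in 𝓝[>] 0, Circle.exp (a + t) ≠ Circle.exp b := by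
  by_cases hab : Circle.exp a = Circle.exp b
  · filter_upwards [Ioo_mem_nhdsGT Real.two_pi_pos] with t ht heq
    rw [Circle.exp_add, hab, mul_eq_left, Circle.exp_eq_one] at heq
    obtain ⟨n, hn⟩ := heq
    rcases le_or_gt n 0 with h | h
    · have : (n : ℝ) * (2 * Real.pi) ≤ 0 := mul_nonpos_of_nonpos_of_nonneg (by exact_mod_cast h) Real.two_pi_pos.le
      linarith [ht.1]
    · have h1 : (1 : ℝ) ≤ n := by exact_mod_cast h
      nlinarith [ht.2, Real.pi_pos]
  · have hopen : IsOpen {t : ℝ | Circle.exp (a + t) ≠ Circle.exp b} :=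
      isOpen_ne_fun (Circle.exp.continuous.comp (continuous_const.add continuous_id)) continuous_const
    have h0 : (0 : ℝ) ∈ {t : ℝ | Circle.exp (a + t) ≠ Circle.exp b} := by simpa using hab
    exact nhdsWithin_le_nhds (hopen.mem_nhds h0)

omit [Fintype W] [DecidableEq W] in
/-- `a + t ≠ 0` for all small `t > 0`. [cite: Shelstad1979, §4 p. 22] -/
private theorem eventually_nhdsGT_add_ne_zero (a : ℝ) : ∀ᶠ t : ℝ in 𝓝[>] 0, a + t ≠ 0 := by
  by_cases ha : a = 0
  · filter_upwards [self_mem_nhdsWithin] with t (ht : 0 < t)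
    rw [ha, zero_add]; exact ht.ne'
  · have hopen : IsOpen {t : ℝ | a + t ≠ 0} := isOpen_ne_fun (continuous_const.add continuous_id) continuous_const
    have h0 : (0 : ℝ) ∈ {t : ℝ | a + t ≠ 0} := by simpa using ha
    exact nhdsWithin_le_nhds (hopen.mem_nhds h0)

omit [DecidableEq W] in
/-- **Push off every wall**: along `c + t • v₀`, `v₀ = (1 in every slot 0)`, every compact place of `S`'s chart is regular and every split coordinate is non-zero for all small `t > 0`
(so `InRegS S`, indeed `RegS S`, is dense at every point, from a fixed direction). [cite: Shelstad1979, §4 p. 22] [cite: Bouaziz1994IntegralesOrbitales, §3.1 p. 579] -/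
theorem eventually_nhdsGT_add_smul_push_mem_regS (S : Finset W) (c : W → Fin 3 → ℝ) :
    ∀ᶠ t : ℝ in 𝓝[>] 0, c + t • (fun (_ : W) (i : Fin 3) => if i = 0 then (1 : ℝ) else 0) ∈ RegS S := by
  have h1 : ∀ w : W, ∀ᶠ t : ℝ in 𝓝[>] 0, Circle.exp (c w 0 + t) ≠ Circle.exp (c w 2) := fun w => eventually_nhdsGT_circleExp_add_ne _ _
  have h2 : ∀ w : W, ∀ᶠ t : ℝ in 𝓝[>] 0, c w 0 + t ≠ 0 := fun w => eventually_nhdsGT_add_ne_zero _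
  filter_upwards [eventually_all.2 h1, eventually_all.2 h2] with t ht1 ht2
  refine ⟨fun w _ => ?_, fun w _ => ?_⟩
  · simpa using ht1 w
  · simpa using ht2 w

/-- **Tangential push along a wall of `w`**: along `c + t • v₁`, `v₁ = (1 in slot 0 at every place ≠ w)`, every OTHER compact place is regular and every split coordinate of
`S` (`w ∉ S`) is non-zero for small `t > 0`, while the place `w` is untouched (semiregular points are dense in each wall sheet). [cite: Shelstad1979, §4 p. 22]
[cite: Bouaziz1994IntegralesOrbitales, §3.2 p. 580] -/
theorem eventually_nhdsGT_add_smul_tangentialPush_semireg (S : Finset W) {w : W} (hw : w ∉ S) (c : W → Fin 3 → ℝ) :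
    ∀ᶠ t : ℝ in 𝓝[>] 0, (∀ w', w' ∉ S → w' ≠ w →
        Circle.exp ((c + t • (fun (w' : W) (i : Fin 3) => if w' = w then (0 : ℝ) else if i = 0 then 1 else 0)) w' 0) ≠
          Circle.exp ((c + t • (fun (w' : W) (i : Fin 3) => if w' = w then (0 : ℝ) else if i = 0 then 1 else 0)) w' 2)) ∧
      ∀ w' ∈ S, (c + t • (fun (w' : W) (i : Fin 3) => if w' = w then (0 : ℝ) else if i = 0 then 1 else 0)) w' 0 ≠ 0 := by
  have h1 : ∀ w' : W, ∀ᶠ t : ℝ in 𝓝[>] 0, Circle.exp (c w' 0 + t) ≠ Circle.exp (c w' 2) := fun w' => eventually_nhdsGT_circleExp_add_ne _ _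
  have h2 : ∀ w' : W, ∀ᶠ t : ℝ in 𝓝[>] 0, c w' 0 + t ≠ 0 := fun w' => eventually_nhdsGT_add_ne_zero _
  filter_upwards [eventually_all.2 h1, eventually_all.2 h2] with t ht1 ht2
  refine ⟨fun w' _ hne => ?_, fun w' hw' => ?_⟩
  · simpa [hne] using ht1 w'
  · have hne : w' ≠ w := fun h => hw (h ▸ hw')
    simpa [hne] using ht2 w'

omit [Fintype W] [DecidableEq W] in
/-- **Sheet separation**: within `|c_{w,0} − c_{w,2} − 2πk₀| < π`, the wall of `w` is the single sheet `c_{w,0} − c_{w,2} = 2πk₀`. [cite: Shelstad1979, §4 p. 22] -/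
private theorem circleExp_ne_of_abs_sub_lt_pi_of_ne {c : W → Fin 3 → ℝ} {w : W} {k₀ : ℤ} (h : |c w 0 - c w 2 - k₀ * (2 * Real.pi)| < Real.pi)
    (hne : c w 0 - c w 2 ≠ k₀ * (2 * Real.pi)) : Circle.exp (c w 0) ≠ Circle.exp (c w 2) := by
  intro heq
  obtain ⟨m, hm⟩ := Circle.exp_eq_exp.1 heq
  have hmk : (m : ℝ) ≠ k₀ := fun h => hne (by rw [hm, h]; ring)
  have hmk' : (1 : ℝ) ≤ |(m : ℝ) - k₀| := by
    rw [← Int.cast_sub, ← Int.cast_abs]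
    exact_mod_cast Int.one_le_abs (sub_ne_zero.2 fun h => hmk (by exact_mod_cast h))
  have h2 : |c w 0 - c w 2 - k₀ * (2 * Real.pi)| = |(m : ℝ) - k₀| * (2 * Real.pi) := by
    rw [hm, show c w 2 + m * (2 * Real.pi) - c w 2 - k₀ * (2 * Real.pi) = ((m : ℝ) - k₀) * (2 * Real.pi) by ring, abs_mul,
      abs_of_pos Real.two_pi_pos]
  rw [h2] at h
  nlinarith [Real.pi_pos]

end Sheets

/-! ## §2 The core gluing theorem -/

section Core

omit [Fintype W] in
/-- The normal `nrm w` moves only the place `w`: slot `0` up, slot `2` down. [cite: Shelstad1979, §4 p. 25] -/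
private theorem add_smul_nrm_apply (c : W → Fin 3 → ℝ) (w : W) (ν : ℝ) (w' : W) (i : Fin 3) :
    (c + ν • nrm w) w' i = c w' i + (if w' = w then (if i = 0 then ν else if i = 2 then -ν else 0) else 0) := by
  by_cases h : w' = w
  · subst h
    fin_cases i <;> simp [nrm]
  · simp [nrm, h]

/-- Jets of two functions agreeing on an open set agree there. [folklore] -/
private theorem iteratedFDeriv_eq_of_eqOn_open_aux {E' : Type*} [NormedAddCommGroup E'] [NormedSpace ℝ E'] {f g : E' → ℂ} {A : Set E'} (hA : IsOpen A)
    (h : EqOn f g A) {z : E'} (hz : z ∈ A) (n : ℕ) : iteratedFDeriv ℝ n f z = iteratedFDeriv ℝ n g z :=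
  ((Filter.eventuallyEq_of_mem (hA.mem_nhds hz) h).iteratedFDeriv ℝ n).eq_of_nhds

/-- The induction behind the core theorem (on the finite set `P` of wall places, for all `N`, `F`). [cite: Bouaziz1994IntegralesOrbitales, §4 pp. 585–586] -/
private theorem core_aux (S : Finset W) (P : Finset W) :
    (∀ w ∈ P, w ∉ S) → ∀ {N : Set (W → Fin 3 → ℝ)}, IsOpen N →
    (∀ c ∈ N, ∀ w, w ∉ S → w ∉ P → Circle.exp (c w 0) ≠ Circle.exp (c w 2)) →
    ∀ {F : (W → Fin 3 → ℝ) → ℂ}, ContDiffOn ℝ ∞ F (N ∩ InRegS S) →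
    (∀ x ∈ N, ∀ n : ℕ, ∃ C : ℝ, ∀ᶠ y in 𝓝 x, y ∈ InRegS S → ‖iteratedFDeriv ℝ n F y‖ ≤ C) →
    (∀ w ∈ P, ∀ s ∈ N, Circle.exp (s w 0) = Circle.exp (s w 2) → (∀ w', w' ∉ S → w' ≠ w → Circle.exp (s w' 0) ≠ Circle.exp (s w' 2)) →
      (∀ w' ∈ S, s w' 0 ≠ 0) → ∀ (n : ℕ) (m : Fin n → W × Fin 3),
      HasOneSidedJump (fun ν : ℝ => iteratedFDeriv ℝ n F (s + ν • nrm w) (fun j => bzAdaptedVec w (m j))) 0) →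
    ContDiffOn ℝ ∞ (extendFrom (N ∩ InRegS S) F) N := by
  classical
  induction P using Finset.induction_on with
  | empty =>
    intro _ N hN hwalls F hF _ _
    have hA : N ∩ InRegS S = N := by
      refine inter_eq_left.2 fun c hc w hw => hwalls c hc w hw (Finset.notMem_empty w)
    rw [hA] at hF ⊢
    exact hF.congr fun x hx => extendFrom_extends hF.continuousOn x hx
  | insert w P₀ hwP₀ ih =>
    intro hPS N hN hwalls F hF hb hj
    have hwS : w ∉ S := hPS w (Finset.mem_insert_self w P₀)
    -- the set of this theorem, and the glued function
    set A : Set (W → Fin 3 → ℝ) := N ∩ InRegS S with hAdef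
    have hAo : IsOpen A := hN.inter (isOpen_inRegS S)
    set G : (W → Fin 3 → ℝ) → ℂ := extendFrom A F with hGdef
    have hGF : EqOn G F A := fun z hz => extendFrom_extends hF.continuousOn z hz
    -- STEP 1: glue across the walls of `P₀` inside `N₀ := N` minus the `w`-walls (induction hypothesis)
    set N₀ : Set (W → Fin 3 → ℝ) := N ∩ {c | Circle.exp (c w 0) ≠ Circle.exp (c w 2)} with hN₀def
    have hN₀o : IsOpen N₀ := hN.inter (isOpen_ne_fun (continuous_circleExp_coord w 0) (continuous_circleExp_coord w 2))
    have hAN₀ : N₀ ∩ InRegS S = A := by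
      ext c
      exact ⟨fun h => ⟨h.1.1, h.2⟩, fun h => ⟨⟨h.1, h.2 w hwS⟩, h.2⟩⟩
    have hG₀ : ContDiffOn ℝ ∞ G N₀ := by
      have h := ih (fun w' hw' => hPS w' (Finset.mem_insert_of_mem hw')) hN₀o
        (fun c hc w' hw'S hw'P => ?_) (F := F) (by rw [hAN₀]; exact hF) (fun x hx n => hb x hx.1 n)
        (fun w' hw' s hs => hj w' (Finset.mem_insert_of_mem hw') s hs.1)
      · rw [hAN₀] at h
        exact h
      · by_cases hww : w' = w
        · subst hww; exact hc.2
        · exact hwalls c hc.1 w' hw'S (by simp [hww, hw'P])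
    have hcontG : ∀ n : ℕ, ContinuousOn (iteratedFDeriv ℝ n G) N₀ := fun n =>
      (hG₀.continuousOn_iteratedFDerivWithin (m := n) (by exact_mod_cast le_top) hN₀o.uniqueDiffOn).congr
        fun z hz => (iteratedFDerivWithin_of_isOpen n hN₀o hz).symm
    -- the jets of `G` on `N₀` obey the (I₁) bounds of `F` (density of `InRegS S` from the direction `v₀`)
    have hGb : ∀ (n : ℕ) (C : ℝ) (V : Set (W → Fin 3 → ℝ)), IsOpen V → (∀ y ∈ V, y ∈ InRegS S → ‖iteratedFDeriv ℝ n F y‖ ≤ C) →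
        ∀ y ∈ V ∩ N₀, ‖iteratedFDeriv ℝ n G y‖ ≤ C := by
      intro n C V hV hCV y hy
      set v₀ : W → Fin 3 → ℝ := fun _ i => if i = 0 then (1 : ℝ) else 0 with hv₀
      have hray : Tendsto (fun t : ℝ => y + t • v₀) (𝓝[>] 0) (𝓝 y) := by
        have hc : Continuous fun t : ℝ => y + t • v₀ := by fun_prop
        simpa using (hc.tendsto 0).mono_left nhdsWithin_le_nhds
      have hmemVN₀ : ∀ᶠ t : ℝ in 𝓝[>] 0, y + t • v₀ ∈ V ∩ N₀ := hray ((hV.inter hN₀o).mem_nhds hy)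
      have hreg := eventually_nhdsGT_add_smul_push_mem_regS S y
      have hlim : Tendsto (fun t : ℝ => iteratedFDeriv ℝ n G (y + t • v₀)) (𝓝[>] 0) (𝓝 (iteratedFDeriv ℝ n G y)) :=
        ((hcontG n).continuousWithinAt hy.2 |>.tendsto).comp (tendsto_nhdsWithin_iff.2 ⟨hray, hmemVN₀.mono fun t ht => ht.2⟩)
      refine le_of_tendsto hlim.norm ?_
      filter_upwards [hmemVN₀, hreg] with t ht hregt
      have hA' : y + t • v₀ ∈ A := ⟨ht.2.1, regS_subset_inRegS S hregt⟩
      rw [iteratedFDeriv_eq_of_eqOn_open_aux hAo hGF hA' n]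
      exact hCV _ ht.1 (regS_subset_inRegS S hregt)
    -- STEP 2: glue across the `w`-sheets, locally
    refine contDiffOn_of_locally_contDiffOn fun x hx => ?_
    by_cases hxw : Circle.exp (x w 0) = Circle.exp (x w 2)
    swap
    · exact ⟨N₀, hN₀o, ⟨hx, hxw⟩, hG₀.mono inter_subset_right⟩
    obtain ⟨k₀, hk₀⟩ := Circle.exp_eq_exp.1 hxw
    obtain ⟨ℓ, hℓ, hℓnrm⟩ := exists_clm_slotDiff w (show (0 : Fin 3) ≠ 2 by decide)
    rw [hcNrm_zero_two] at hℓnrm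
    set a : ℝ := k₀ * (2 * Real.pi) with hadef
    have hℓx : ℓ x = a := by rw [hℓ, hk₀]; ring
    set u : Set (W → Fin 3 → ℝ) := {c | |ℓ c - a| < Real.pi} with hudef
    have huo : IsOpen u := isOpen_lt (continuous_abs.comp (ℓ.continuous.sub continuous_const)) continuous_const
    have hxu : x ∈ u := by simp [hudef, hℓx, Real.pi_pos]
    set U : Set (W → Fin 3 → ℝ) := N ∩ u with hUdef
    have hUo : IsOpen U := hN.inter huo
    -- off the sheet, points of `U` are off all `w`-sheets
    have hsep : ∀ c ∈ U, ℓ c ≠ a → c ∈ N₀ := by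
      intro c hc hca
      refine ⟨hc.1, circleExp_ne_of_abs_sub_lt_pi_of_ne (k₀ := k₀) ?_ ?_⟩
      · have h2 : |ℓ c - a| < Real.pi := hc.2
        rwa [hℓ] at h2
      · rwa [hℓ] at hca
    have hsheet : ∀ c, ℓ c = a → Circle.exp (c w 0) = Circle.exp (c w 2) := by
      intro c hc
      rw [hℓ] at hc
      exact Circle.exp_eq_exp.2 ⟨k₀, by rw [hadef] at hc; linarith⟩
    -- the adapted basis at `w`
    obtain ⟨bs, hbs⟩ := exists_basis_hcAdaptedVec w (show (0 : Fin 3) ≠ 2 by decide)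
    have hbs' : ∀ {n : ℕ} (kk : Fin n → W × Fin 3), (fun i => bs (kk i)) = fun j => bzAdaptedVec w (kk j) := by
      intro n kk; funext i; rw [hbs, bzAdaptedVec_eq_hcAdaptedVec]
    -- the four inputs of ★ `contDiffOn_extendFrom_of_tendsto_iteratedFDeriv_ray_basis_of_dense`
    have hf' : ContDiffOn ℝ ∞ G (U ∩ {y | ℓ y ≠ a}) := hG₀.mono fun c hc => hsep c hc.1 hc.2
    have hb' : ∀ x' ∈ U, ℓ x' = a → ∀ n : ℕ, ∃ C : ℝ, ∀ᶠ y in 𝓝 x', ℓ y ≠ a → ‖iteratedFDeriv ℝ n G y‖ ≤ C := by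
      intro x' hx' _ n
      obtain ⟨C, hC⟩ := hb x' hx'.1 n
      obtain ⟨V, hVsub, hVo, hxV⟩ := mem_nhds_iff.1 hC
      refine ⟨C, ?_⟩
      filter_upwards [hVo.mem_nhds hxV, hUo.mem_nhds hx'] with y hyV hyU hya
      exact hGb n C V hVo (fun z hz hzr => hVsub hz hzr) y ⟨hyV, hsep y hyU hya⟩
    set Dsr : Set (W → Fin 3 → ℝ) := {s | (∀ w', w' ∉ S → w' ≠ w → Circle.exp (s w' 0) ≠ Circle.exp (s w' 2)) ∧ ∀ w' ∈ S, s w' 0 ≠ 0} with hDsr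
    have hD' : U ∩ {y | ℓ y = a} ⊆ closure (Dsr ∩ {y | ℓ y = a}) := by
      intro x'' hx''
      set v₁ : W → Fin 3 → ℝ := fun w' i => if w' = w then (0 : ℝ) else if i = 0 then 1 else 0 with hv₁
      have hray : Tendsto (fun t : ℝ => x'' + t • v₁) (𝓝[>] 0) (𝓝 x'') := by
        have hc : Continuous fun t : ℝ => x'' + t • v₁ := by fun_prop
        simpa using (hc.tendsto 0).mono_left nhdsWithin_le_nhds
      refine mem_closure_of_tendsto hray ?_
      filter_upwards [eventually_nhdsGT_add_smul_tangentialPush_semireg S hwS x''] with t ht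
      refine ⟨ht, ?_⟩
      show ℓ (x'' + t • v₁) = a
      rw [map_add, map_smul, hx''.2]
      simp [hℓ, hv₁]
    have hj' : ∀ x'' ∈ Dsr, x'' ∈ U → ℓ x'' = a → ∀ (n : ℕ) (kk : Fin n → W × Fin 3), ∃ l : ℂ,
        Tendsto (fun t : ℝ => iteratedFDeriv ℝ n G (x'' + t • nrm w) fun i => bs (kk i)) (𝓝[>] 0) (𝓝 l) ∧
        Tendsto (fun t : ℝ => iteratedFDeriv ℝ n G (x'' + t • nrm w) fun i => bs (kk i)) (𝓝[<] 0) (𝓝 l) := by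
      intro x'' hx''D hx''U hx''a n kk
      obtain ⟨Lp, Lm, hp, hm, h0⟩ := hj w (Finset.mem_insert_self w P₀) x'' hx''U.1 (hsheet x'' hx''a) hx''D.1 hx''D.2 n kk
      have hLm : Lm = Lp := by rw [← sub_eq_zero, ← neg_sub, h0, neg_zero]
      -- near `t = 0`, `t ≠ 0`, the ray lies in `A`, where `G = F`
      have hnear : ∀ᶠ t : ℝ in 𝓝[≠] 0, x'' + t • nrm w ∈ A := by
        have h1 : ∀ᶠ t : ℝ in 𝓝[≠] (0 : ℝ), x'' + t • nrm w ∈ N := by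
          have hc : Continuous fun t : ℝ => x'' + t • nrm w := by fun_prop
          have h0 : Tendsto (fun t : ℝ => x'' + t • nrm w) (𝓝 0) (𝓝 x'') := by simpa using hc.tendsto 0
          exact nhdsWithin_le_nhds (h0 (hN.mem_nhds hx''U.1))
        have h2 : ∀ᶠ t : ℝ in 𝓝[≠] (0 : ℝ), |t| < Real.pi / 2 :=
          (continuous_abs.continuousAt.eventually (gt_mem_nhds (by simpa using half_pos Real.pi_pos))).filter_mono nhdsWithin_le_nhds
        filter_upwards [h1, h2, self_mem_nhdsWithin] with t ht1 ht2 (ht0 : t ≠ 0)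
        refine ⟨ht1, fun w' hw' => ?_⟩
        by_cases hww : w' = w
        · subst hww
          refine circleExp_ne_of_abs_sub_lt_pi_of_ne (k₀ := k₀) ?_ ?_
          · have e1 : (x'' + t • nrm w') w' 0 - (x'' + t • nrm w') w' 2 - k₀ * (2 * Real.pi) = 2 * t := by
              have := hx''a; rw [hℓ] at this
              rw [add_smul_nrm_apply, add_smul_nrm_apply]; simp; linarith
            rw [e1, abs_mul, abs_two]; linarith
          · have e1 : (x'' + t • nrm w') w' 0 - (x'' + t • nrm w') w' 2 = k₀ * (2 * Real.pi) + 2 * t := by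
              have := hx''a; rw [hℓ] at this
              rw [add_smul_nrm_apply, add_smul_nrm_apply]; simp; linarith
            rw [e1]; intro h; exact ht0 (by linarith)
        · have e0 : (x'' + t • nrm w) w' 0 = x'' w' 0 := by rw [add_smul_nrm_apply]; simp [hww]
          have e2 : (x'' + t • nrm w) w' 2 = x'' w' 2 := by rw [add_smul_nrm_apply]; simp [hww]
          rw [e0, e2]
          exact hx''D.1 w' hw' hww
      have hcongr : ∀ᶠ t : ℝ in 𝓝[≠] 0, iteratedFDeriv ℝ n F (x'' + t • nrm w) (fun j => bzAdaptedVec w (kk j)) =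
          iteratedFDeriv ℝ n G (x'' + t • nrm w) (fun i => bs (kk i)) := by
        filter_upwards [hnear] with t ht
        rw [hbs' kk, iteratedFDeriv_eq_of_eqOn_open_aux hAo hGF ht n]
      exact ⟨Lp, hp.congr' (hcongr.filter_mono (nhdsGT_le_nhdsNE 0)), (hLm ▸ hm).congr' (hcongr.filter_mono (nhdsLT_le_nhdsNE 0))⟩
    have hglue := contDiffOn_extendFrom_of_tendsto_iteratedFDeriv_ray_basis_of_dense ℓ a bs (v := nrm w) (by rw [hℓnrm]; norm_num) hUo hf' hb' hD' hj'
    -- STEP 3: the new glue IS `G` on `U`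
    refine ⟨u, huo, hxu, hglue.congr fun y hy => ?_⟩
    by_cases hya : ℓ y ≠ a
    · exact (extendFrom_eq_self_of_contDiffOn (ℓ := ℓ) (a := a) hf' ⟨hy, hya⟩).symm
    push Not at hya
    -- at a sheet point: both sides are the limit of `F` along `A`
    have hyc : y ∈ closure A := by
      set v₀ : W → Fin 3 → ℝ := fun _ i => if i = 0 then (1 : ℝ) else 0 with hv₀
      have hray : Tendsto (fun t : ℝ => y + t • v₀) (𝓝[>] 0) (𝓝 y) := by
        have hc : Continuous fun t : ℝ => y + t • v₀ := by fun_prop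
        simpa using (hc.tendsto 0).mono_left nhdsWithin_le_nhds
      refine mem_closure_of_tendsto hray ?_
      filter_upwards [eventually_nhdsGT_add_smul_push_mem_regS S y, hray (hN.mem_nhds hy.1)] with t ht htN
      exact ⟨htN, regS_subset_inRegS S ht⟩
    have hgc : ContinuousAt (extendFrom (U ∩ {y | ℓ y ≠ a}) G) y := (hglue.continuousOn.continuousWithinAt hy).continuousAt (hUo.mem_nhds hy)
    refine extendFrom_eq hyc ?_
    refine ((hgc.tendsto).mono_left nhdsWithin_le_nhds).congr' ?_
    have hU_nhds : ∀ᶠ z in 𝓝[A] y, z ∈ U := mem_nhdsWithin_of_mem_nhds (hUo.mem_nhds hy)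
    filter_upwards [hU_nhds, self_mem_nhdsWithin] with z hzU hzA
    have hza : ℓ z ≠ a := fun h => (hzA.2 w hwS) (hsheet z h)
    rw [extendFrom_eq_self_of_contDiffOn (ℓ := ℓ) (a := a) hf' ⟨hzU, hza⟩]
    exact hGF hzA

/-- **(W1) ZERO-JUMP GLUING, GROUP-FREE CORE.**  On an open set `N` of the coordinate space of the `H`-Cartan of type `S` whose only walls are the noncompact imaginary walls
(`e^{i c_{w,0}} = e^{i c_{w,2}}`, every `2π`-sheet) of the compact places `w ∈ P`: a function `F` that is `C^∞` on `N ∩ InRegS S` with locally bounded jets ((I₁)(I₂)) and whose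
ray jets along `nrm w` have ZERO one-sided jump at every SEMIREGULAR point of every sheet of every `P`-wall in `N` (adapted words ★ `bzAdaptedVec`) extends — by ★ `extendFrom` — to a
`C^∞` function on all of `N`, the `k`-fold corners and the real walls included (wall by wall: ★ `contDiffOn_extendFrom_of_tendsto_iteratedFDeriv_ray_basis_of_dense`, the semiregular
points being dense in each sheet). [cite: Bouaziz1994IntegralesOrbitales, §3.2 (I₁)–(I₃) p. 580; §4 pp. 585–586] [cite: Shelstad1979, §4 p. 25] -/
theorem contDiffOn_extendFrom_inRegS_of_hasOneSidedJump_zero (S P : Finset W) (hPS : ∀ w ∈ P, w ∉ S) {N : Set (W → Fin 3 → ℝ)} (hN : IsOpen N)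
    (hwalls : ∀ c ∈ N, ∀ w, w ∉ S → w ∉ P → Circle.exp (c w 0) ≠ Circle.exp (c w 2))
    {F : (W → Fin 3 → ℝ) → ℂ} (hF : ContDiffOn ℝ ∞ F (N ∩ InRegS S))
    (hb : ∀ x ∈ N, ∀ n : ℕ, ∃ C : ℝ, ∀ᶠ y in 𝓝 x, y ∈ InRegS S → ‖iteratedFDeriv ℝ n F y‖ ≤ C)
    (hj : ∀ w ∈ P, ∀ s ∈ N, Circle.exp (s w 0) = Circle.exp (s w 2) → (∀ w', w' ∉ S → w' ≠ w → Circle.exp (s w' 0) ≠ Circle.exp (s w' 2)) →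
      (∀ w' ∈ S, s w' 0 ≠ 0) → ∀ (n : ℕ) (m : Fin n → W × Fin 3),
      HasOneSidedJump (fun ν : ℝ => iteratedFDeriv ℝ n F (s + ν • nrm w) (fun j => bzAdaptedVec w (m j))) 0) :
    ContDiffOn ℝ ∞ (extendFrom (N ∩ InRegS S) F) N :=
  core_aux S P hPS hN hwalls hF hb hj

omit [DecidableEq W] in
/-- **Rider: the glue is the family off the walls.** [cite: Bouaziz1994IntegralesOrbitales, §3.2 (I₁)–(I₂) p. 579] -/
theorem extendFrom_inRegS_eq_self {N : Set (W → Fin 3 → ℝ)} {S : Finset W} {F : (W → Fin 3 → ℝ) → ℂ} (hF : ContDiffOn ℝ ∞ F (N ∩ InRegS S)) :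
    EqOn (extendFrom (N ∩ InRegS S) F) F (N ∩ InRegS S) := fun z hz =>
  extendFrom_extends hF.continuousOn z hz

end Core

/-! ## §3 (W1′): the tube currency of the filtration road -/

section Tube

omit [Fintype W] [DecidableEq W] in
/-- A product `g · h` of a factor `g → g₀` and a factor `h` with ZERO one-sided jump has zero one-sided jump. [cite: Shelstad1979, §4 p. 25] -/
private theorem hasOneSidedJump_zero_mul_of_tendsto {g h : ℝ → ℂ} {g₀ : ℂ} (hg : Tendsto g (𝓝 0) (𝓝 g₀)) (hh : HasOneSidedJump h 0) :
    HasOneSidedJump (fun ν => g ν * h ν) 0 := by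
  obtain ⟨Lp, Lm, hp, hm, hJ⟩ := hh
  have hLm : Lm = Lp := by rw [← sub_eq_zero, ← neg_sub, hJ, neg_zero]
  exact ⟨g₀ * Lp, g₀ * Lp, (hg.mono_left nhdsWithin_le_nhds).mul hp, (hg.mono_left nhdsWithin_le_nhds).mul (hLm ▸ hm), sub_self _⟩

omit [Fintype W] [DecidableEq W] in
/-- Zero one-sided jumps survive negation. [cite: Shelstad1979, §4 p. 25] -/
private theorem hasOneSidedJump_zero_neg {h : ℝ → ℂ} (hh : HasOneSidedJump h 0) : HasOneSidedJump (fun ν => -h ν) 0 := by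
  obtain ⟨Lp, Lm, hp, hm, hJ⟩ := hh
  exact ⟨-Lp, -Lm, hp.neg, hm.neg, by rw [sub_eq_zero.1 hJ, sub_self]⟩

omit [Fintype W] [DecidableEq W] in
/-- Zero one-sided jumps are stable under eventual equality on the two sides. [cite: Shelstad1979, §4 p. 25] -/
private theorem hasOneSidedJump_zero_congr {f g : ℝ → ℂ} (h : HasOneSidedJump f 0) (hfg : ∀ᶠ ν in 𝓝[≠] (0 : ℝ), f ν = g ν) :
    HasOneSidedJump g 0 := by
  obtain ⟨Lp, Lm, hp, hm, hJ⟩ := h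
  exact ⟨Lp, Lm, hp.congr' (hfg.filter_mono (nhdsGT_le_nhdsNE 0)), hm.congr' (hfg.filter_mono (nhdsLT_le_nhdsNE 0)), hJ⟩

/-- **A member of `I^st_c` that vanishes on the regular part of an open class tube vanishes on its in-regular part** (continuity (I₁) + density of `RegS` from the push direction).
[cite: Bouaziz1994IntegralesOrbitales, §3.1 (I₁)–(I₂) p. 579] -/
theorem eq_zero_of_eq_zero_on_regS_tube {jcH : Finset W → W → ℂ} {D : Finset W → (W → Fin 3 → ℝ) → ℂ} (hD : ArchBouazizSpaceH jcH D) (S' : Finset W)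
    (b : W → ℂ × ℂ × ℂ) {ε : ℝ} (hvan : ∀ c, c ∈ RegS S' → dist (bzClassMap S' c) b < ε → D S' c = 0)
    {c : W → Fin 3 → ℝ} (hc : c ∈ InRegS S') (hcb : dist (bzClassMap S' c) b < ε) : D S' c = 0 := by
  set v₀ : W → Fin 3 → ℝ := fun _ i => if i = 0 then (1 : ℝ) else 0 with hv₀
  have hray : Tendsto (fun t : ℝ => c + t • v₀) (𝓝[>] 0) (𝓝 c) := by
    have hc' : Continuous fun t : ℝ => c + t • v₀ := by fun_prop
    simpa using (hc'.tendsto 0).mono_left nhdsWithin_le_nhds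
  have hO : IsOpen {c : W → Fin 3 → ℝ | dist (bzClassMap S' c) b < ε} :=
    isOpen_lt ((continuous_bzClassMap S').dist continuous_const) continuous_const
  have hcont : ContinuousWithinAt (D S') (InRegS S') c := ((hD.smoothBounded S').1.continuousOn) c hc
  have hreg := eventually_nhdsGT_add_smul_push_mem_regS S' c
  have hlim : Tendsto (fun t : ℝ => D S' (c + t • v₀)) (𝓝[>] 0) (𝓝 (D S' c)) :=
    hcont.tendsto.comp (tendsto_nhdsWithin_iff.2 ⟨hray, hreg.mono fun t ht => regS_subset_inRegS S' ht⟩)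
  have hzero : ∀ᶠ t : ℝ in 𝓝[>] 0, D S' (c + t • v₀) = 0 := by
    filter_upwards [hreg, hray (hO.mem_nhds hcb)] with t ht htb
    exact hvan _ ht htb
  exact tendsto_nhds_unique hlim (tendsto_const_nhds.congr' (hzero.mono fun t ht => ht.symm))

/-- **(W1′) ZERO-JUMP GLUING IN TUBE CURRENCY — the `hW1` organ of ★ `wallGerm_classMultiple_of_parts` (p851576), token for token after `(jcH S P b hPS)`.**  For a member `D` of
★ `ArchBouazizSpaceH jcH`, a chart `S`, a set `P` of compact places, a base class `b` and a radius `ε > 0` such that the class `ε`-tube of `S` meets no wall of a compact place outside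
`P`: if `D` VANISHES on the regular `ε`-tube of every more-split chart `insert w S`, `w ∈ P`, then `archERho S · D S` agrees on the in-regular part of the tube with a function `G`
that is `C^∞` on the WHOLE open tube `{c | dist (bzClassMap S c) b < ε}` — corners, real walls and every `2π`-sheet included.  By (I₃) every jump is `jcH · I^# ·` (a jet of
`archERho S′ · D S′` at the Cayley point, whose class lies in the same tube (★ `bzClassMap_insert_cayPt`), where `D S′ ≡ 0`) `= 0`; the other sheets by (P) + ★
`archERho_add_angleShift_zero` (`= ±` the sheet-`0` jets, ★ `iteratedFDeriv_comp_add_right`); then the core theorem glues (`G := extendFrom (tube ∩ InRegS S) (archERho S · D S)`).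
[cite: Bouaziz1994IntegralesOrbitales, §3.2 (I₃) p. 580; §4 pp. 585–586; §5.1 p. 588] [cite: Shelstad1979, §4 p. 25] -/
theorem exists_contDiffOn_tube_eq_archERho_mul_of_eq_zero (jcH : Finset W → W → ℂ) (S P : Finset W) (b : W → ℂ × ℂ × ℂ) (hPS : ∀ w ∈ P, w ∉ S) :
    ∀ ε : ℝ, 0 < ε → (∀ c : W → Fin 3 → ℝ, dist (bzClassMap S c) b < ε → ∀ w, w ∉ S → w ∉ P → Circle.exp (c w 0) ≠ Circle.exp (c w 2)) →
      ∀ D : Finset W → (W → Fin 3 → ℝ) → ℂ, ArchBouazizSpaceH jcH D →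
        (∀ w ∈ P, ∀ c, c ∈ RegS (insert w S) → dist (bzClassMap (insert w S) c) b < ε → D (insert w S) c = 0) →
        ∃ G : (W → Fin 3 → ℝ) → ℂ, ContDiffOn ℝ ∞ G {c | dist (bzClassMap S c) b < ε} ∧
          ∀ c, c ∈ InRegS S → dist (bzClassMap S c) b < ε → G c = archERho S c * D S c := by
  intro ε _ hwalls D hD hvan
  set N : Set (W → Fin 3 → ℝ) := {c | dist (bzClassMap S c) b < ε} with hNdef
  have hNo : IsOpen N := isOpen_lt ((continuous_bzClassMap S).dist continuous_const) continuous_const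
  set F : (W → Fin 3 → ℝ) → ℂ := fun c => archERho S c * D S c with hFdef
  have hDS : ContDiffOn ℝ ∞ (D S) (InRegS S) := (hD.smoothBounded S).1
  have hF : ContDiffOn ℝ ∞ F (N ∩ InRegS S) := ((contDiff_archERho S).contDiffOn.mul hDS).mono inter_subset_right
  refine ⟨extendFrom (N ∩ InRegS S) F, contDiffOn_extendFrom_inRegS_of_hasOneSidedJump_zero S P hPS hNo (fun c hc => hwalls c hc) hF ?_ ?_,
    fun c hc hcb => extendFrom_inRegS_eq_self hF ⟨hcb, hc⟩⟩
  · -- (I₁) bounds for the twisted family near every point (★ Leibniz on the compact closed unit ball)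
    intro x _ n
    have hK : IsCompact (Metric.closedBall x 1) := isCompact_closedBall x 1
    have hbdd := bddAbove_norm_iteratedFDeriv_mul_inter_of_isCompact (isOpen_inRegS S) isOpen_univ hK (subset_univ _)
      (contDiff_archERho S).contDiffOn hDS (n := n) fun i _ => (hD.smoothBounded S).2 i _ hK
    obtain ⟨C, hC⟩ := hbdd
    refine ⟨C, ?_⟩
    filter_upwards [Metric.closedBall_mem_nhds x one_pos] with y hy hyr
    exact hC ⟨y, ⟨hy, hyr⟩, rfl⟩
  · -- ZERO JUMPS on every sheet of every `P`-wall in the tube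
    intro w hwP s hsN hsw hsr hsS n m
    have hwS : w ∉ S := hPS w hwP
    obtain ⟨k, hk⟩ := Circle.exp_eq_exp.1 hsw
    -- the sheet-`0` representative `s₀ := s − 2πk·e_{w,0}`
    set s₀ : W → Fin 3 → ℝ := s + angleShift w 0 (-k) with hs₀def
    have hs₀0 : s₀ w 0 = s₀ w 2 := by
      simp only [hs₀def, Pi.add_apply, angleShift_apply_self, angleShift_apply_self_of_ne w (show (2 : Fin 3) ≠ 0 by decide), add_zero, hk]
      push_cast; ring
    have hs₀ne : ∀ w', w' ≠ w → ∀ i, s₀ w' i = s w' i := fun w' hw' i => by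
      simp only [hs₀def, Pi.add_apply, angleShift_apply_of_ne hw', Pi.zero_apply, add_zero]
    have hsr₀ : ∀ w', w' ∉ S → w' ≠ w → Circle.exp (s₀ w' 0) ≠ Circle.exp (s₀ w' 2) := fun w' hw'S hw' => by
      rw [hs₀ne w' hw', hs₀ne w' hw']; exact hsr w' hw'S hw'
    have hsS₀ : ∀ w' ∈ S, s₀ w' 0 ≠ 0 := fun w' hw' => by
      rw [hs₀ne w' (fun h => hwS (h ▸ hw'))]; exact hsS w' hw'
    have hss₀ : s = s₀ + angleShift w 0 k := by
      have hsum : angleShift w 0 (-k) + angleShift w 0 k = (0 : W → Fin 3 → ℝ) := by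
        simp only [angleShift, ← Pi.single_add]
        push_cast
        ring_nf
        simp
      rw [hs₀def, add_assoc, hsum, add_zero]
    -- (I₃) at `s₀`: the Cayley-side jet vanishes, so the twisted ray jet of `D S` has zero jump
    have hI3 := hD.jump S w hwS s₀ hs₀0 hsr₀ hsS₀ n m
    have hcay0 : bzTwistedDeriv (insert w S) n (fun j => bzCayVec (m j)) (D (insert w S)) (cayPt w s₀) = 0 := by
      -- `archERho S′ · D S′ ≡ 0` on the open set `InRegS S′ ∩ tube`, which contains the Cayley point
      set O' : Set (W → Fin 3 → ℝ) := InRegS (insert w S) ∩ {c | dist (bzClassMap (insert w S) c) b < ε} with hO'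
      have hO'o : IsOpen O' := (isOpen_inRegS _).inter (isOpen_lt ((continuous_bzClassMap _).dist continuous_const) continuous_const)
      have hcayO' : cayPt w s₀ ∈ O' := by
        refine ⟨fun w' hw' => ?_, ?_⟩
        · have hw'w : w' ≠ w := fun h => hw' (h ▸ Finset.mem_insert_self w S)
          simpa [cayPt_apply_of_ne hw'w] using hsr₀ w' (fun h => hw' (Finset.mem_insert_of_mem h)) hw'w
        · show dist (bzClassMap (insert w S) (cayPt w s₀)) b < ε
          rw [bzClassMap_insert_cayPt S hwS hs₀0, hs₀def, bzClassMap_add_angleShift S s (Or.inl hwS)]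
          exact hsN
      have hzero : EqOn (fun c => archERho (insert w S) c * D (insert w S) c) (fun _ => 0) O' := fun c hc => by
        show archERho (insert w S) c * D (insert w S) c = 0
        rw [eq_zero_of_eq_zero_on_regS_tube hD (insert w S) b (hvan w hwP) hc.1 hc.2, mul_zero]
      unfold bzTwistedDeriv
      rw [((Filter.eventuallyEq_of_mem (hO'o.mem_nhds hcayO') hzero).iteratedFDeriv ℝ n).eq_of_nhds, iteratedFDeriv_fun_zero]
      simp
    rw [hcay0, mul_zero] at hI3
    -- undo the twist: the plain ray jet of `F` at `s₀` has zero jump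
    have hplain₀ : HasOneSidedJump (fun ν : ℝ => iteratedFDeriv ℝ n F (s₀ + ν • nrm w) (fun j => bzAdaptedVec w (m j))) 0 := by
      have hEρ : Tendsto (fun ν : ℝ => archERho S (s₀ + ν • nrm w)) (𝓝 0) (𝓝 (archERho S s₀)) := by
        have hc : Continuous fun ν : ℝ => archERho S (s₀ + ν • nrm w) := (contDiff_archERho S).continuous.comp (by fun_prop)
        simpa using hc.tendsto 0
      refine hasOneSidedJump_zero_congr (hasOneSidedJump_zero_mul_of_tendsto hEρ hI3) (Eventually.of_forall fun ν => ?_)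
      show archERho S (s₀ + ν • nrm w) * bzTwistedDeriv S n (fun j => bzAdaptedVec w (m j)) (D S) (s₀ + ν • nrm w) = _
      unfold bzTwistedDeriv
      rw [← mul_assoc, mul_inv_cancel₀ (archERho_ne_zero S _), one_mul]
    -- transport to the sheet of `s`: `F (c + 2πk e_{w,0}) = (−1)^k F c`
    have hshift : ∀ c, F (c + angleShift w 0 k) = (-1) ^ k * F c := fun c => by
      simp only [hFdef, archERho_add_angleShift_zero S c hwS k, hD.periodic S c w 0 k (Or.inl hwS), mul_assoc]
    have hray : ∀ ν : ℝ, s + ν • nrm w = (s₀ + ν • nrm w) + angleShift w 0 k := fun ν => by rw [hss₀]; abel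
    have hjet : ∀ ν : ℝ, iteratedFDeriv ℝ n F (s + ν • nrm w) = iteratedFDeriv ℝ n (fun c => F (c + angleShift w 0 k)) (s₀ + ν • nrm w) := fun ν => by
      rw [hray ν, iteratedFDeriv_comp_add_right]
    rcases Int.even_or_odd k with hke | hko
    · have hF' : (fun c => F (c + angleShift w 0 k)) = F := by
        funext c; rw [hshift c, hke.neg_one_zpow, one_mul]
      refine hasOneSidedJump_zero_congr hplain₀ (Eventually.of_forall fun ν => ?_)
      rw [hjet ν, hF']
    · have hF' : (fun c => F (c + angleShift w 0 k)) = -F := by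
        funext c; rw [hshift c, hko.neg_one_zpow, neg_one_mul, Pi.neg_apply]
      refine hasOneSidedJump_zero_congr (hasOneSidedJump_zero_neg hplain₀) (Eventually.of_forall fun ν => ?_)
      rw [hjet ν, hF', iteratedFDeriv_neg_apply]
      rfl

/-- **(W1′) IN THE PAYER'S `P`-FREE CURRENCY — the `hW1` organ of ★ p851580 `bzLocalSurjWall_of_bricks` (`ArchBouazizWallSurjectiveOfBricks`), token for token after
`jcH`**: the wall places are «`w ∉ S` with `b` central at `w`» (`(b w).1 ^ 2 = 4 * (b w).2.1`) instead of a `Finset` `P`; instantiate the previous theorem at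
`P := (univ \ S).filter (central)`. [cite: Bouaziz1994IntegralesOrbitales, §3.2 (I₃) p. 580; §4 pp. 585–586] [cite: Shelstad1979, §4 p. 25] -/
theorem exists_contDiffOn_tube_eq_archERho_mul_of_eq_zero_central (jcH : Finset W → W → ℂ) :
    ∀ (S : Finset W) (b : W → ℂ × ℂ × ℂ) (ε : ℝ), 0 < ε →
      (∀ c : W → Fin 3 → ℝ, dist (bzClassMap S c) b < ε → ∀ w, w ∉ S → (b w).1 ^ 2 ≠ 4 * (b w).2.1 → Circle.exp (c w 0) ≠ Circle.exp (c w 2)) →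
      ∀ D : Finset W → (W → Fin 3 → ℝ) → ℂ, ArchBouazizSpaceH jcH D →
        (∀ w, w ∉ S → (b w).1 ^ 2 = 4 * (b w).2.1 → ∀ c, c ∈ RegS (insert w S) → dist (bzClassMap (insert w S) c) b < ε → D (insert w S) c = 0) →
        ∃ G : (W → Fin 3 → ℝ) → ℂ, ContDiffOn ℝ ∞ G {c | dist (bzClassMap S c) b < ε} ∧
          ∀ c, c ∈ InRegS S → dist (bzClassMap S c) b < ε → G c = archERho S c * D S c := by
  classical
  intro S b ε hε hwalls D hD hvan
  set P : Finset W := (Finset.univ \ S).filter fun w => (b w).1 ^ 2 = 4 * (b w).2.1 with hPdef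
  have hP : ∀ w, w ∈ P ↔ w ∉ S ∧ (b w).1 ^ 2 = 4 * (b w).2.1 := fun w => by
    simp only [hPdef, Finset.mem_filter, Finset.mem_sdiff, Finset.mem_univ, true_and]
  refine exists_contDiffOn_tube_eq_archERho_mul_of_eq_zero jcH S P b (fun w hw => ((hP w).1 hw).1) ε hε (fun c hc w hwS hwP => ?_) D hD
    (fun w hw c hc hcb => hvan w ((hP w).1 hw).1 ((hP w).1 hw).2 c hc hcb)
  exact hwalls c hc w hwS fun h => hwP ((hP w).2 ⟨hwS, h⟩)

end Tube


end Literature.NumberTheory.Rogawski1990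

end
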